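import Summits.HodgeConjecture.HodgeConjecture.Theses.TropicalWeilObstruction
import Summits.HodgeConjecture.HodgeConjecture.Theorems.TropicalWeilObstructionTropicalHodgeBoundWeilPairing
import HarnessLib

/-!
# Crux `TropicalHodgeBound` (route `TropicalWeilObstruction`), line `birth`: registered stub
# `stub_weilPairing_weilClasses` — `Ŵ(w₁(Q)), Ŵ(w₂(Q))` are `ℚ`-independent — and the crux BY NAME
# from the remaining stub 4

Registered skeleton `Cruxes/TropicalHodgeBound/Lines/birth.lean` (crux item stmt-HodgeConjecture-18480).
The skeleton-local `dzCoord`, `weilPairing` (`Ŵ`), `thetaClass`, `omegaFrame`, `weilClassC/Re/Im` and the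
stub statements `WeilPairingWeilClasses`, `RationalHodgeCoordinates` are rendered by file-local `notation3`
with the skeleton's bodies verbatim (display only; nothing is defined), so `stub_weilPairing_weilClasses`
carries the REGISTERED signature and is definitionally the skeleton's statement.

* `stub_weilPairing_weilClasses`: for `Q ≻ 0`, `Ŵ(w₁) + iŴ(w₂) = 2⁴ det (P Q Pᴴ) ≠ 0` and
  `Ŵ(w₁) - iŴ(w₂) = det (P Q Pᵀ) · det (P Pᵀ) = 0` (`weilPairing_weilClasses_indep` of the sibling file
  `…WeilPairing`, `n = 4`; the `J`-commutation hypothesis is not needed for this step).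
* `tropicalHodgeBound_of_rationalHodgeCoordinates`: the crux
  `Summit.HodgeConjecture.HodgeConjecture.Theses.TropicalWeilObstruction.TropicalHodgeBound` BY NAME from the
  one remaining registered stub `stub_rationalHodgeCoordinates` (the L content: rational tropical Hodge
  coordinates `(θ₄, w₁, w₂)` at Weil-generic `Q` — Mikhalkin–Zharkov Prop. 4.3 / Thm. 5.4 plus the generic
  rank-3 certificate), by the skeleton's 25-line composition with stubs 1–3 discharged
  (`stub_weilFunctional_eq_pairing`, `weilPairing_thetaClass_eq_zero`, this file).

HONEST STATUS. Linear algebra of the `dz ⊗ dz` pairing only; stub 4 is NOT touched and nothing here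
bears on the Hodge conjecture itself. No definition, no named fact, no sorry.
References: [cite: Zharkov2020TropicalWeil, §2] [cite: MikhalkinZharkov2014Eigenwave, Prop. 4.3 and Thm. 5.4].
-/

set_option linter.dupNamespace false

noncomputable section

open scoped BigOperators
open Matrix
open Literature.AlgebraicGeometry.Tropical

namespace Summit.HodgeConjecture.HodgeConjecture.Theorems.TropicalHodgeBound

/-! ## §0 Display-only notation (the skeleton's local definitions, verbatim bodies) -/

/-- The skeleton's `dzCoord n S`. -/
local notation3 (prettyPrint := false) "dz⟦" n "⟧" S:max =>
  (Matrix.det (Matrix.of fun k a : Fin n =>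
    (if (S a : ℕ) = (k : ℕ) then (1 : ℂ) else 0) + (if (S a : ℕ) = (k : ℕ) + n then Complex.I else 0)))

/-- The skeleton's `weilPairing n C` (the value `Ŵ(C)`). -/
local notation3 (prettyPrint := false) "Ŵ⟦" n "⟧" C:max =>
  (∑ S : Fin n → Fin (2 * n), ∑ S' : Fin n → Fin (2 * n),
    dz⟦n⟧ S * dz⟦n⟧ S' / ((Nat.factorial n : ℂ) ^ 2) * ((C S S' : ℝ) : ℂ))

/-- The skeleton's `thetaClass n Q`. -/
local notation3 (prettyPrint := false) "θ⟦" n "⟧" Q:max =>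
  (fun S S' : Fin n → Fin (2 * n) => Matrix.det (Matrix.submatrix Q S S'))

/-- The skeleton's `omegaFrame n` (`Ω`, the frame `ω_b = e_b - i e_{b+n}`). -/
local notation3 (prettyPrint := false) "Ω⟦" n "⟧" =>
  (Matrix.of fun (a : Fin (2 * n)) (b : Fin n) =>
    (if (a : ℕ) = (b : ℕ) then (1 : ℂ) else 0) - (if (a : ℕ) = (b : ℕ) + n then Complex.I else 0))

/-- The skeleton's `weilClassC n Q` (`w(Q) = (⋀ⁿQ ⊗ 1)(Ω ⊗ Ω)`). -/
local notation3 (prettyPrint := false) "wC⟦" n "⟧" Q:max =>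
  (fun S S' : Fin n → Fin (2 * n) =>
    Matrix.det (Matrix.submatrix (Matrix.map Q ((↑) : ℝ → ℂ) * Ω⟦n⟧) S id) *
      Matrix.det (Matrix.submatrix (Ω⟦n⟧) S' id))

/-- The skeleton's `weilClassRe n Q` (`w₁ = Re w`). -/
local notation3 (prettyPrint := false) "wRe⟦" n "⟧" Q:max =>
  (fun S S' : Fin n → Fin (2 * n) => Complex.re ((wC⟦n⟧ Q) S S'))

/-- The skeleton's `weilClassIm n Q` (`w₂ = Im w`). -/
local notation3 (prettyPrint := false) "wIm⟦" n "⟧" Q:max =>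
  (fun S S' : Fin n → Fin (2 * n) => Complex.im ((wC⟦n⟧ Q) S S'))

/-- The skeleton's `WeilPairingWeilClasses` (stub 3 statement). -/
local notation3 (prettyPrint := false) "WeilPairingWeilClasses" =>
  (∀ Q : Matrix (Fin (2 * 4)) (Fin (2 * 4)) ℝ, Matrix.PosDef Q → Q * weilJ 4 = weilJ 4 * Q →
    ∀ s t : ℚ, (s : ℂ) * Ŵ⟦4⟧ (wRe⟦4⟧ Q) + (t : ℂ) * Ŵ⟦4⟧ (wIm⟦4⟧ Q) = 0 → s = 0 ∧ t = 0)

/-- The skeleton's `RationalHodgeCoordinates` (stub 4 statement, the open L content; hypothesis only). -/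
local notation3 (prettyPrint := false) "RationalHodgeCoordinates" =>
  (∀ Q : Matrix (Fin (2 * 4)) (Fin (2 * 4)) ℝ, Matrix.PosDef Q → Q * weilJ 4 = weilJ 4 * Q →
    IsWeilGeneric 4 Q → ∀ Z : TropicalTorusCycle (2 * 4) 4 Q, ∃ q : Fin 3 → ℚ,
      TropicalTorusCycle.cyc Z = ((q 0 : ℚ) : ℝ) • θ⟦4⟧ Q + ((q 1 : ℚ) : ℝ) • wRe⟦4⟧ Q +
        ((q 2 : ℚ) : ℝ) • wIm⟦4⟧ Q)

/-! ## §1 The registered stub 3 (`n = 4`) -/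

/-- **Stub 3 (registered): `Ŵ(w₁(Q)), Ŵ(w₂(Q))` are `ℚ`-independent for `Q ≻ 0`, `QJ = JQ`** (the
`J`-commutation is not used). [cite: Zharkov2020TropicalWeil, §2] -/
theorem stub_weilPairing_weilClasses : WeilPairingWeilClasses :=
  fun Q hQ _ s t h => weilPairing_weilClasses_indep (by norm_num) Q hQ s t h

/-! ## §2 The crux BY NAME from the remaining stub 4 -/

/-- **`TropicalHodgeBound` from `RationalHodgeCoordinates` alone** (the skeleton's composition
`TropicalHodgeBound_of_pieces` with stubs 1–3 discharged by this file): `Ŵ(cyc c_j) = W(c_j) = 0`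
kills the `w₁, w₂` coordinates, so the three classes lie on the rational line through `θ₄(Q)`.
[cite: Zharkov2020TropicalWeil, §2] [cite: MikhalkinZharkov2014Eigenwave, Prop. 4.3 and Thm. 5.4] -/
theorem tropicalHodgeBound_of_rationalHodgeCoordinates (h₄ : RationalHodgeCoordinates) :
    Summit.HodgeConjecture.HodgeConjecture.Theses.TropicalWeilObstruction.TropicalHodgeBound := by
  intro Q hQ hJ hgen c hW
  choose q hq using fun j => h₄ Q hQ hJ hgen (c j)
  have hq12 : ∀ j, q j 1 = 0 ∧ q j 2 = 0 := by
    intro j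
    refine stub_weilPairing_weilClasses Q hQ hJ (q j 1) (q j 2) ?_
    have h0 : Ŵ⟦4⟧ (TropicalTorusCycle.cyc (c j)) = 0 := by
      rw [← stub_weilFunctional_eq_pairing Q (c j)]; exact hW j
    have hθ : Ŵ⟦4⟧ (θ⟦4⟧ Q) = 0 := weilPairing_thetaClass_eq_zero (by norm_num) Q hJ
    rw [hq j] at h0
    simp only [Pi.add_apply, Pi.smul_apply, smul_eq_mul, Complex.ofReal_add, Complex.ofReal_mul,
      Complex.ofReal_ratCast, mul_add, Finset.sum_add_distrib] at h0
    have e1 : ∀ (r : ℚ) (C : (Fin 4 → Fin (2 * 4)) → (Fin 4 → Fin (2 * 4)) → ℝ),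
        ∑ S : Fin 4 → Fin (2 * 4), ∑ S' : Fin 4 → Fin (2 * 4),
          dz⟦4⟧ S * dz⟦4⟧ S' / ((Nat.factorial 4 : ℂ) ^ 2) * ((r : ℂ) * ((C S S' : ℝ) : ℂ)) =
        (r : ℂ) * Ŵ⟦4⟧ C := by
      intro r C
      rw [Finset.mul_sum]
      refine Finset.sum_congr rfl fun S _ => ?_
      rw [Finset.mul_sum]
      refine Finset.sum_congr rfl fun S' _ => ?_
      ring
    rw [e1, e1, e1, hθ, mul_zero, zero_add] at h0
    exact h0
  have hθ : ∀ j, TropicalTorusCycle.cyc (c j) = ((q j 0 : ℚ) : ℝ) • θ⟦4⟧ Q := by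
    intro j
    rw [hq j, (hq12 j).1, (hq12 j).2]
    simp
  rw [Fintype.not_linearIndependent_iff]
  by_cases h00 : q 0 0 = 0
  · refine ⟨![1, 0, 0], ?_, ⟨0, by simp⟩⟩
    simp only [Fin.sum_univ_three]
    rw [hθ 0, h00]
    simp
  · refine ⟨![q 1 0, -(q 0 0), 0], ?_, ⟨1, by simpa using h00⟩⟩
    simp only [Fin.sum_univ_three]
    rw [hθ 0, hθ 1]
    funext S S'
    simp only [Matrix.cons_val_zero, Matrix.cons_val_one, Matrix.cons_val_two, Matrix.head_cons,
      Matrix.tail_cons, Pi.add_apply, Pi.smul_apply, Pi.zero_apply, smul_eq_mul, zero_smul,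
      add_zero, Rat.smul_def]
    push_cast
    ring


end Summit.HodgeConjecture.HodgeConjecture.Theorems.TropicalHodgeBound

end
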